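import Literature.NumberTheory.EllipticCurves.ZpExtensionEisensteinTwistLocalH1UniformBoundProofs
import Literature.NumberTheory.EllipticCurves.ZpExtensionUnramifiedProofs
import Literature.NumberTheory.EllipticCurves.ZpExtensionEisensteinDVRSetting
import HarnessLib

/-!
# `#(⊤ ⧸ F) ≤ p^{8N}` for every subgroup `F` of `H¹(K_v, T^{(j)})` of Howard's Eisenstein tower at a finitely decomposed `v ∤ p`,
# with ONE exponent over all `v ∣ N` — the (B5-BAD) local index of the shared μ-crux's `Stmt.readoutIndex` (proofs)

`Proofs` file (theorems only; no definition, no named fact, no instance, no `sorry`) in topic `NumberTheory/EllipticCurves`;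
sequel to x9-p1-w4's `ZpExtensionEisensteinTwistLocalH1UniformBoundProofs`
(`ZpExtension.natCard_galoisCohomology_one_restrictField_eisensteinTwist_le_pow`: `#H¹(F, E[p^j] ⊗ A_{m,j}(ψ)) ≤ p^{8N}` for every
`j ≥ 1` and every `m > 2N`, `F` a `K`-field, non-archimedean local of characteristic `0` with residue characteristic `∤ p`, ONE
`h ∈ Γ_F` with `κ(h) = N ≥ 1`).  This file packages that CARDINALITY bound (not only the torsion exponent) for the consumer:

* §1 at a finite place `v ∤ p` of a number field: **`natCard_galoisCohomology_one_toLocal_eisensteinTwist_le_pow`** (the bound for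
  `GaloisRep.toLocal v`), `ZpExtension.exists_toAdd_apply_absGaloisRestrict_adicCompletion_eq_pow` (one `h ∈ Γ_{K_v}` with
  `κ(h) = p^e` when `¬ D_v ≤ ker κ`) and the UNIFORM exponent over the finitely many places above a non-zero `n`
  (**`ZpExtension.exists_forall_toAdd_apply_absGaloisRestrict_eq_pow_of_natCast_mem`**: one `e` with, at every `v ∋ n`, `v ∌ p`
  finitely decomposed in `K_∞`, an `h_v ∈ Γ_{K_v}` with `κ(h_v) = p^e` — maximum over `v ∣ n`, then raise to a `p`-power);
* §2 the letter for the shared μ-crux (cell `pub/bsd-print-x9`, stmt-BirchSwinnertonDyer-23428, STUB B, clause (B5)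
  `Stmt.readoutIndex`, place-wise input (B5-BAD) of `WeierstrassCurve.finite_and_natCard_kerPsi_quotient_eisensteinTowerReadout_le_of_local`
  with the relaxed condition `F'_{j,v} := ⊤` at `v ∈ S`, `v ∤ p`): **`WeierstrassCurve.finite_and_natCard_top_quotient_le_pow_eisensteinTower`**
  — for the curve `E = W_K` and Howard's tower `T^{(j)} = E[p^{j+1}] ⊗ A_{m,j+1}(ψ⁻¹)` (`W.eisensteinTower (κ.unitTwist (-1)) hm`),
  EVERY subgroup `F` of `H¹(K_v, T^{(j)})` (e.g. Howard's propagated `condA … j (Sum.inr v)`) has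
  `Finite (⊤ ⧸ F) ∧ #(⊤ ⧸ F) ≤ p^{8N}` for all `j`, all `m > 2N` — so the local index at the places `v ∣ N`, `v ∤ p` is
  bounded by a constant chosen BEFORE `m` (and before `S`, via §1's uniform exponent over `v ∣ N`).

HONEST FRAMING: this is the `v ∤ p`, `v ∈ Σ` clause of Howard's Lemma 2.2.7 («`H¹(K_v, A_𝔮)` is finite with order bounded …»)
at `𝔮 = T^m + p`, where the printed «depending only on `[S_𝔮 : Λ/𝔮]`» is replaced by the honest `m`-uniform count `p^{8N}`
(`N` the exact `p`-power value of `κ` on `Γ_{K_v}`); no reduction type of `E` enters.  BSD is not proved by any of this.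

References: [Howard2004HeegnerKolyvagin] B. Howard, Compositio Math. 140 (2004), §1.3 H.4, §2.2 Lemma 2.2.7 / Prop. 2.2.8
and proof of Thm. 2.2.10 (arXiv:1202.6340 p. 16 L142–152, p. 17 L41–53, p. 18 L16–17); [MilneADT2006] I Thm. 2.8, Cor. 2.3;
[SerreGaloisCohomology1997] I §1.4 (closed subgroups of `ℤ_p`); [NeukirchANT1999] Ch. I §3.
-/

noncomputable section

open Field IsNonarchimedeanLocalField ValuativeRel
open scoped Classical

universe u

namespace Literature.NumberTheory.EllipticCurves

open Literature.NumberTheory.GaloisRepresentations Literature.NumberTheory.GaloisRepresentations.DiscreteGaloisModule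
  IwasawaAlgebra IwasawaAlgebra.EisensteinCoeff Literature.Algebra.Module

/-! ## §0 Quotients of a finite group by a subgroup of `⊤` -/

/-- For a finite additive group `G` with `#G ≤ C` and any subgroup `F`, the quotient `⊤ ⧸ F` (of the top subgroup by `F` viewed
inside it) is finite of order `≤ C`. [folklore] -/
private theorem finite_and_natCard_top_quotient_addSubgroupOf_le {G : Type u} [AddCommGroup G] [Finite G] (F : AddSubgroup G)
    {C : ℕ} (hC : Nat.card G ≤ C) :
    Finite (↥(⊤ : AddSubgroup G) ⧸ F.addSubgroupOf ⊤) ∧ Nat.card (↥(⊤ : AddSubgroup G) ⧸ F.addSubgroupOf ⊤) ≤ C := by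
  haveI : Finite (↥(⊤ : AddSubgroup G)) := Finite.of_injective _ Subtype.val_injective
  refine ⟨inferInstance, ?_⟩
  calc Nat.card (↥(⊤ : AddSubgroup G) ⧸ F.addSubgroupOf ⊤)
      ≤ Nat.card (↥(⊤ : AddSubgroup G)) := Nat.card_le_card_of_surjective _ (QuotientAddGroup.mk_surjective)
    _ ≤ Nat.card G := Nat.card_le_card_of_injective _ Subtype.val_injective
    _ ≤ C := hC


/-! ## §1 At a finite place `v ∤ p` of a number field -/

section AdicCompletion

open IsDedekindDomain NumberField
open scoped NumberField

variable {K : Type} [Field K] [NumberField K]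

/-- `ringChar 𝓀[K_v] ∤ p` for `v ∤ p` (the residue characteristic is a prime `≠ p`). [folklore] -/
private theorem not_ringChar_residueField_adicCompletion_dvd_of_natCast_not_mem (v : HeightOneSpectrum (𝓞 K)) {p : ℕ}
    [hp : Fact p.Prime] (hpv : ((p : ℕ) : 𝓞 K) ∉ v.asIdeal) : ¬ ringChar 𝓀[v.adicCompletion K] ∣ p := by
  intro hd
  rcases (Nat.dvd_prime hp.out).1 hd with h1 | h2
  · exact (ringChar_residueField_prime (F := v.adicCompletion K)).one_lt.ne' h1
  · exact v.ringChar_residueField_adicCompletion_ne hpv h2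

/-- **`#H¹(K_v, E[p^j] ⊗ A_{m,j}(ψ)) ≤ p^{8N}` at a finite place `v ∤ p`**, for every `j ≥ 1` and `m > 2N`, given
`h ∈ Γ_{K_v}` with `κ(h) = N ≥ 1` (`v` finitely decomposed in `K_∞`). [cite: Howard2004HeegnerKolyvagin, §2.2 Lemma 2.2.7 and proof of Thm. 2.2.10]
[cite: MilneADT2006, I Thm. 2.8] -/
theorem natCard_galoisCohomology_one_toLocal_eisensteinTwist_le_pow (W : WeierstrassCurve K) [W.IsElliptic] {p : ℕ}
    [hp : Fact p.Prime] (κ : ZpExtension K p) (v : HeightOneSpectrum (𝓞 K)) (hpv : ((p : ℕ) : 𝓞 K) ∉ v.asIdeal)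
    (h : absoluteGaloisGroup (v.adicCompletion K)) {N : ℕ} (hN : 1 ≤ N)
    (hσ : (κ (absGaloisRestrict K (v.adicCompletion K) h)).toAdd = (N : ℤ_[p])) {m : ℕ} (hm : 1 ≤ m)
    (hmN : 2 * N < m) (j : ℕ) (hj : 1 ≤ j) :
    Nat.card (galoisCohomology (GaloisRep.toLocal v
      (κ.eisensteinTwist (W.torsionGaloisModule ((p : ℤ) ^ j)) hm j)) 1) ≤ p ^ (8 * N) := by
  haveI : CharZero (v.adicCompletion K) :=
    charZero_of_injective_algebraMap (algebraMap K (v.adicCompletion K)).injective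
  have hpK : (p : K) ≠ 0 := Nat.cast_ne_zero.mpr hp.out.ne_zero
  exact κ.natCard_galoisCohomology_one_restrictField_eisensteinTwist_le_pow W hm (v.adicCompletion K) hpK
    (not_ringChar_residueField_adicCompletion_dvd_of_natCast_not_mem v hpv) h hN hσ hmN j hj

/-- **One element of `Γ_{K_v}` with `κ = p^e` at a place not splitting completely in `K_∞`** (`¬ D_v ≤ ker κ`).
[cite: SerreGaloisCohomology1997, I §1.4 (closed subgroups of ℤ_p)] -/
theorem ZpExtension.exists_toAdd_apply_absGaloisRestrict_adicCompletion_eq_pow {p : ℕ} [hp : Fact p.Prime]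
    (κ : ZpExtension K p) (v : HeightOneSpectrum (𝓞 K)) (hdec : ¬ (GreenbergSelmer.decomp v ≤ κ.kerSubgroup)) :
    ∃ (e : ℕ) (h : absoluteGaloisGroup (v.adicCompletion K)),
      (κ (absGaloisRestrict K (v.adicCompletion K) h)).toAdd = ((p ^ e : ℕ) : ℤ_[p]) := by
  obtain ⟨h₀, hh₀⟩ : ∃ h₀ : absoluteGaloisGroup (v.adicCompletion K),
      κ (absGaloisRestrict K (v.adicCompletion K) h₀) ≠ 1 := by
    by_contra hall
    push Not at hall
    exact hdec fun δ hδ ↦ by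
      obtain ⟨σ, rfl⟩ := (GreenbergSelmer.mem_decomp_iff v δ).1 hδ
      exact ZpExtension.mem_kerSubgroup.2 (hall σ)
  exact κ.exists_toAdd_apply_absGaloisRestrict_eq_pow (v.adicCompletion K) h₀ hh₀

omit [NumberField K] in
/-- Raising an element with `κ = p^e` to the power `p^d` gives one with `κ = p^{e+d}`. [folklore] -/
private theorem ZpExtension.toAdd_apply_pow_prime_pow {p : ℕ} [hp : Fact p.Prime] (κ : ZpExtension K p)
    {F' : Type} [Field F'] [Algebra K F'] (h : absoluteGaloisGroup F') {e : ℕ}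
    (hh : (κ (absGaloisRestrict K F' h)).toAdd = ((p ^ e : ℕ) : ℤ_[p])) (d : ℕ) :
    (κ (absGaloisRestrict K F' (h ^ p ^ d))).toAdd = ((p ^ (e + d) : ℕ) : ℤ_[p]) := by
  rw [map_pow, map_pow, toAdd_pow, hh, nsmul_eq_mul, pow_add, Nat.cast_mul, mul_comm]

/-- **A uniform exponent over the places above `n`.**  If every place `v ∋ n` with `v ∌ p` is finitely decomposed in `K_∞`
(`¬ D_v ≤ ker κ`), there is ONE `e` such that at every such `v` some `h_v ∈ Γ_{K_v}` has `κ(h_v) = p^e` (the set of places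
above the non-zero `n` is finite; take the maximum exponent and raise). [cite: SerreGaloisCohomology1997, I §1.4]
[cite: NeukirchANT1999, Ch. I §3 (finitely many primes above an ideal)] -/
theorem ZpExtension.exists_forall_toAdd_apply_absGaloisRestrict_eq_pow_of_natCast_mem {p : ℕ} [hp : Fact p.Prime]
    (κ : ZpExtension K p) {n : ℕ} (hn0 : n ≠ 0)
    (hdec : ∀ v : HeightOneSpectrum (𝓞 K), ((n : ℕ) : 𝓞 K) ∈ v.asIdeal → ((p : ℕ) : 𝓞 K) ∉ v.asIdeal →
      ¬ (GreenbergSelmer.decomp v ≤ κ.kerSubgroup)) :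
    ∃ e : ℕ, ∀ v : HeightOneSpectrum (𝓞 K), ((n : ℕ) : 𝓞 K) ∈ v.asIdeal → ((p : ℕ) : 𝓞 K) ∉ v.asIdeal →
      ∃ h : absoluteGaloisGroup (v.adicCompletion K),
        (κ (absGaloisRestrict K (v.adicCompletion K) h)).toAdd = ((p ^ e : ℕ) : ℤ_[p]) := by
  -- the finite set of places above `n`
  have hI : (Ideal.span {((n : ℕ) : 𝓞 K)} : Ideal (𝓞 K)) ≠ 0 := by
    rw [Ne, Submodule.zero_eq_bot, Ideal.span_singleton_eq_bot]
    exact_mod_cast hn0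
  have hfin : {v : HeightOneSpectrum (𝓞 K) | ((n : ℕ) : 𝓞 K) ∈ v.asIdeal}.Finite := by
    refine (Ideal.finite_factors hI).subset fun v hv ↦ ?_
    exact (Ideal.dvd_span_singleton).2 hv
  -- a local exponent at each such place
  let ev : HeightOneSpectrum (𝓞 K) → ℕ := fun v ↦
    if hv : ((n : ℕ) : 𝓞 K) ∈ v.asIdeal ∧ ((p : ℕ) : 𝓞 K) ∉ v.asIdeal then
      Classical.choose (κ.exists_toAdd_apply_absGaloisRestrict_adicCompletion_eq_pow v (hdec v hv.1 hv.2))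
    else 0
  have hev : ∀ v, ∀ hv : ((n : ℕ) : 𝓞 K) ∈ v.asIdeal ∧ ((p : ℕ) : 𝓞 K) ∉ v.asIdeal,
      ∃ h : absoluteGaloisGroup (v.adicCompletion K),
        (κ (absGaloisRestrict K (v.adicCompletion K) h)).toAdd = ((p ^ ev v : ℕ) : ℤ_[p]) := by
    intro v hv
    have hs := Classical.choose_spec (κ.exists_toAdd_apply_absGaloisRestrict_adicCompletion_eq_pow v (hdec v hv.1 hv.2))
    simp only [ev, dif_pos hv]
    exact hs
  refine ⟨hfin.toFinset.sup ev, fun v hnv hpv ↦ ?_⟩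
  obtain ⟨h, hh⟩ := hev v ⟨hnv, hpv⟩
  have hle : ev v ≤ hfin.toFinset.sup ev := Finset.le_sup (hfin.mem_toFinset.2 hnv)
  refine ⟨h ^ p ^ (hfin.toFinset.sup ev - ev v), ?_⟩
  rw [κ.toAdd_apply_pow_prime_pow h hh, Nat.add_sub_cancel' hle]

end AdicCompletion

/-! ## §2 The letter (B5-BAD): `#(⊤ ⧸ F) ≤ p^{8N}` for every subgroup `F` of `H¹(K_v, T^{(j)})`, Howard's tower of the curve -/

section Curve

open IsDedekindDomain NumberField WeierstrassCurve
open Literature.NumberTheory.GaloisCohomology.Howard2004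
open scoped NumberField

variable {K : Type} [Field K] [NumberField K] (W : WeierstrassCurve ℚ) [W.IsElliptic] {p : ℕ} [hp : Fact p.Prime]
  (κ : ZpExtension K p) {m : ℕ} (hm : 1 ≤ m)

/-- **(B5-BAD) The local index at a place `v ∤ p` finitely decomposed in `K_∞` is `≤ p^{8N}`, uniformly in the tower level
and in `m > 2N`.**  For `E = W_K`, Howard's tower `T^{(j)} = E[p^{j+1}] ⊗ A_{m,j+1}(ψ⁻¹)` (`W.eisensteinTower (κ.unitTwist (-1)) hm`),
`h ∈ Γ_{K_v}` with `κ⁻¹`-value `N ≥ 1` (`κ⁻¹ = κ.unitTwist (-1)`), `m > 2N`, every tower level `j` and EVERY subgroup `F` of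
`H¹(K_v, T^{(j)})` — in particular Howard's propagated condition `condA … j (Sum.inr v)` — the quotient `⊤ ⧸ F` is finite
of order `≤ p^{8N}`: the relaxed condition `F' := ⊤` of the (B5) wrapper at the places `v ∣ N`, `v ∤ p`.
[cite: Howard2004HeegnerKolyvagin, §2.2 Lemma 2.2.7 / Prop. 2.2.8 and proof of Thm. 2.2.10 (𝔮 = T^m + p)]
[cite: MilneADT2006, I Thm. 2.8] -/
theorem _root_.WeierstrassCurve.finite_and_natCard_top_quotient_le_pow_eisensteinTower (v : HeightOneSpectrum (𝓞 K))
    (hpv : ((p : ℕ) : 𝓞 K) ∉ v.asIdeal) (h : absoluteGaloisGroup (v.adicCompletion K)) {N : ℕ} (hN : 1 ≤ N)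
    (hσ : ((κ.unitTwist (-1)) (absGaloisRestrict K (v.adicCompletion K) h)).toAdd = (N : ℤ_[p])) (hmN : 2 * N < m)
    (j : ℕ) :
    letI := IwasawaAlgebra.isLocalRing_quotient_X_pow_add_C p hm
    ∀ F : AddSubgroup (galoisCohomology (((W.eisensteinTower (κ.unitTwist (-1)) hm).ρ j).toLocal (Sum.inr v)) 1),
      Finite (↥(⊤ : AddSubgroup (galoisCohomology (((W.eisensteinTower (κ.unitTwist (-1)) hm).ρ j).toLocal (Sum.inr v)) 1)) ⧸
          F.addSubgroupOf ⊤) ∧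
        Nat.card (↥(⊤ : AddSubgroup (galoisCohomology (((W.eisensteinTower (κ.unitTwist (-1)) hm).ρ j).toLocal
          (Sum.inr v)) 1)) ⧸ F.addSubgroupOf ⊤) ≤ p ^ (8 * N) := by
  letI := IwasawaAlgebra.isLocalRing_quotient_X_pow_add_C p hm
  intro F
  have hpp := hp.out
  have hpK : (p : K) ≠ 0 := Nat.cast_ne_zero.mpr hpp.ne_zero
  haveI : CharZero (v.adicCompletion K) :=
    charZero_of_injective_algebraMap (algebraMap K (v.adicCompletion K)).injective
  -- the level module is finite, so `H¹(K_v, T^{(j)})` is finite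
  obtain ⟨e⟩ := nonempty_addEquiv_geomTorsion (W.baseChange K) p (j + 1) (Nat.succ_pos j) hpK
  have hidx : (W.baseChange K).geomTorsion ((p ^ (j + 1) : ℕ) : ℤ) = (W.baseChange K).geomTorsion ((p : ℤ) ^ (j + 1)) := by
    rw [Nat.cast_pow]
  haveI : Finite (Twisted p m (j + 1) ((W.baseChange K).geomTorsion ((p : ℤ) ^ (j + 1)))) := by
    apply Nat.finite_of_card_ne_zero
    rw [Twisted.natCard_eq_of_addEquiv hm ((AddEquiv.addSubgroupCongr hidx).symm.trans e)]
    exact pow_ne_zero _ hpp.ne_zero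
  haveI : Finite (galoisCohomology (((W.eisensteinTower (κ.unitTwist (-1)) hm).ρ j).toLocal (Sum.inr v)) 1) :=
    finite_galoisCohomology_one_of_isNonarchimedeanLocalField
      (GaloisRep.restrictField (v.adicCompletion K)
        ((κ.unitTwist (-1)).eisensteinTwist ((W.baseChange K).torsionGaloisModule ((p : ℤ) ^ (j + 1))) hm (j + 1)))
  refine finite_and_natCard_top_quotient_addSubgroupOf_le F ?_
  exact natCard_galoisCohomology_one_toLocal_eisensteinTwist_le_pow (W.baseChange K) (κ.unitTwist (-1)) v hpv h hN hσ
    hm hmN (j + 1) (Nat.succ_pos j)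

end Curve

end Literature.NumberTheory.EllipticCurves

end
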